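/-
Copyright: public-domain mathematics; typed transcription for the H21 Literature library (cell lit-balaban,
reader/typer seat r02 gen 5 = literature-prover-lit-balaban-r02-g5-0).

statement-level skeleton of published theorems with citation tags; proofs where landed; nothing here is a claim about the Yang–Mills mass gap

# Bałaban, *Propagators and renormalization transformations for lattice gauge theories. I*,
# Commun. Math. Phys. **95** (1984) 17–40 — the maps of the (1.132) carrier AT THE SETTINGS OF RECORD:
# `Carrier133 (B5G0DiagTorus.famDiagTop d L a 0 i) (latticeSettingP12R …)` — σ, ι, κ and the `MapFacts` norm/support fields

[cite: Balaban1984PropagatorsI]  T. Bałaban, Commun. Math. Phys. 95 (1984) 17–40.  p. 39 (1.132); p. 35 (1.108)–(1.109); p. 33 (1.89).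

WHAT THIS MODULE ADDS (SKELETON row B5.Prop1.2 census (vii), (1.132) half; sequel of `B5Carrier132Maps`/`B5Carrier132Iota` for p37's
diagonal G₀ setting `B5G0DiagTorus.g0Diag P a m² k` (v2: sources = own `LocT P`)):
the `MapFacts` fields of `B5Transfer132` at the types of `g0Diag P a 0 P.K` (G₀ side, `S'`) and `latticeSettingP12R (nP P) (MP P) a P.K`
(G side, `S₀`) for the maps `σR`, `ιR`, `κR`, as standalone theorems: `dist_le` (`dist_σR`, equality), `supp_map` (`supp_ιR`), `cut_map`
(`cutIn_κR`), `supNorm_map` (`supNormT_ιR_le`), `holder_map` (`holder3_ιR_le` — every kind, via the generic `holN_emb_le`: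
`holN ≤ holderSeminormB5` componentwise), `cutH_map` (`cutHV_κR_le`); bundled as `mapFacts_core`; and `‖ι J‖ = ‖J‖` (`l2NormT_ιR`).
The remaining `MapFacts`/`PieceFacts132` fields concern the pieces `1_{Δ(y″)}∂P∂*G^{(p)}J` (next).

HONEST SCOPE.  Bookkeeping; nothing analytic.
-/
import Mathlib
import Literature.MathematicalPhysics.QuantumFieldTheory.Balaban1983to89.B5Carrier132Iota
import Literature.MathematicalPhysics.QuantumFieldTheory.Balaban1983to89.B5G0DiagTorus

open scoped BigOperators Matrix Real
open Finset Matrix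

namespace Literature.MathematicalPhysics.QuantumFieldTheory.Balaban1983to89.B5Carrier132Maps

open Literature.MathematicalPhysics.QuantumFieldTheory.Balaban1983to89
open Literature.MathematicalPhysics.QuantumFieldTheory.Balaban1983to89.B5Prop11Plancherel (Tor fine)
open Literature.MathematicalPhysics.QuantumFieldTheory.Balaban1983to89.B5SiteBridgeP12 (nP MP eFine eUnit distX_K_eq)
open Literature.MathematicalPhysics.QuantumFieldTheory.Balaban1983to89.B5Prop12FieldsLattice (distU supNormL holderL holderT holderT2)
open Literature.MathematicalPhysics.QuantumFieldTheory.Balaban1983to89.B5SettingP12Real (LocR latticeSettingP12R)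
open Literature.MathematicalPhysics.QuantumFieldTheory.Balaban1983to89.B5TowerSourcesG0 (LocT suppInT l2NormT)
open Literature.MathematicalPhysics.QuantumFieldTheory.Balaban1983to89.B5G0DiagTorus (holder3 holG g0Diag)
open Literature.MathematicalPhysics.QuantumFieldTheory.Balaban1983to89.B5GpSettingTorus (supNormV holderV)
open Literature.MathematicalPhysics.QuantumFieldTheory.Balaban1983to89.B5Ineq137Torus (T distX supN holN T_nonneg eq_of_distX_eq_zero)
open Literature.MathematicalPhysics.QuantumFieldTheory.Balaban1983to89.LatticeNorms (supNorm supNorm_nonneg norm_le_supNorm holderSeminormB5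
  holderSeminorm_nonneg holder_bound)

noncomputable section

variable (P : Params)

/-! ## The Hölder dictionary on the tensor kinds and the `MapFacts` fields at the types of record -/

/-- **the Hölder dictionary, generic form**: for any index type `κ` carrying fine sites `site : κ → T_η` and an embedding
`emb : Site P 0 → κ` over `eFine` along which `sameDir` holds, p37's `holN P K ε (f ∘ emb)` is at most r19's
`holderSeminormB5 ε sameDir (distU on sites) univ f` (pairs `|x − x′| ≤ 1`, `x ≠ x′` of `holN` are admissible pairs at the same
distance `distX_K_eq`; `x = x′` contributes 0). [cite: Balaban1984PropagatorsI, (1.109) p.35] -/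
theorem holN_emb_le {κ : Type} [Fintype κ] [DecidableEq κ] (ε : ℝ) (sameDir : κ → κ → Prop)
    (site : κ → Tor (fine (nP P) (MP P))) (f : κ → ℝ) (emb : Site P 0 → κ)
    (hsite : ∀ x, site (emb x) = eFine P x) (hdir : ∀ x x', sameDir (emb x) (emb x')) :
    holN P P.K ε (fun x => f (emb x))
      ≤ holderSeminormB5 ε sameDir (fun b b' => distU (nP P) (MP P) (site b) (site b')) Finset.univ (fun b => (f b : ℂ)) := by
  have hH0 : 0 ≤ holderSeminormB5 ε sameDir (fun b b' => distU (nP P) (MP P) (site b) (site b')) Finset.univ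
      (fun b => (f b : ℂ)) := holderSeminorm_nonneg _ _ _ _ _ _
  refine Finset.sup'_le _ _ fun p _ => ?_
  obtain ⟨x, x'⟩ := p
  dsimp only
  split_ifs with hle
  · by_cases hxx : x = x'
    · subst hxx
      rw [sub_self, abs_zero, zero_div]
      exact hH0
    · have hpos : 0 < distX P P.K x x' :=
        lt_of_le_of_ne (by unfold distX; have := T_nonneg P 0 x x'; positivity) fun h => hxx (eq_of_distX_eq_zero P h.symm)
      rw [distX_K_eq] at hle hpos
      rw [distX_K_eq, div_le_iff₀ (Real.rpow_pos_of_pos hpos ε)]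
      have hb := holder_bound (α := ε) (adm := fun b b' : κ => sameDir b b' ∧ distU (nP P) (MP P) (site b) (site b') ≤ 1)
        (dist := fun b b' => distU (nP P) (MP P) (site b) (site b')) (τ := fun _ _ => id) (S := Finset.univ)
        (fun b => (f b : ℂ)) (Finset.mem_univ (emb x)) (Finset.mem_univ (emb x'))
        ⟨hdir x x', by rw [hsite, hsite]; exact hle⟩ (by rw [hsite, hsite]; exact hpos)
      simp only [id, hsite] at hb
      rw [← Complex.ofReal_sub, Complex.norm_real, Real.norm_eq_abs] at hb
      exact hb
  · exact hH0

/-- the Hölder dictionary for a component of a TENSOR source: `holN` of `x ↦ T_ν(eFine x, μ)` ≤ `holderT` of `T`.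
[cite: Balaban1984PropagatorsI, (1.109) p.35] -/
theorem holN_pull_ten_le (ε : ℝ) (T : Fin P.d → Tor (fine (nP P) (MP P)) × Fin P.d → ℝ) (ν μ : Fin P.d) :
    holN P P.K ε (fun x => T ν (eFine P x, μ)) ≤ holderT (nP P) (MP P) ε (fun ν b => ((T ν b : ℝ) : ℂ)) :=
  holN_emb_le P ε (fun p p' : Fin P.d × (Tor (fine (nP P) (MP P)) × Fin P.d) => p.1 = p'.1 ∧ p.2.2 = p'.2.2)
    (fun p => p.2.1) (fun p => T p.1 p.2) (fun x => (ν, (eFine P x, μ))) (fun _ => rfl) (fun _ _ => ⟨rfl, rfl⟩)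

/-- the same for a 3-tensor source. [cite: Balaban1984PropagatorsI, (1.109) p.35] -/
theorem holN_pull_ten2_le (ε : ℝ) (T : Fin P.d × Fin P.d → Tor (fine (nP P) (MP P)) × Fin P.d → ℝ) (q : Fin P.d × Fin P.d)
    (μ : Fin P.d) :
    holN P P.K ε (fun x => T q (eFine P x, μ)) ≤ holderT2 (nP P) (MP P) ε (fun q b => ((T q b : ℝ) : ℂ)) :=
  holN_emb_le P ε (fun p p' : (Fin P.d × Fin P.d) × (Tor (fine (nP P) (MP P)) × Fin P.d) => p.1 = p'.1 ∧ p.2.2 = p'.2.2)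
    (fun p => p.2.1) (fun p => T p.1 p.2) (fun x => (q, (eFine P x, μ))) (fun _ => rfl) (fun _ _ => ⟨rfl, rfl⟩)

/-- **`holder_map`: `‖ι J‖_ε ≤ ‖J‖_ε`** at the types of record, every kind. [cite: Balaban1984PropagatorsI, (1.109) p.35] -/
theorem holder3_ιR_le (a ε : ℝ) (J : LocR (nP P) (MP P)) :
    holder3 P P.K ε (ιR P J) ≤ (latticeSettingP12R (nP P) (MP P) a P.K).holder ε J := by
  cases J with
  | vec J => exact holderV_pullV_le P ε J
  | ten T =>
      exact Finset.sup'_le ⟨(B5GpSettingTorus.dir0 P, B5GpSettingTorus.dir0 P), Finset.mem_univ _⟩ _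
        fun p _ => holN_pull_ten_le P ε T p.1 p.2
  | ten2 T =>
      exact Finset.sup'_le ⟨((B5GpSettingTorus.dir0 P, B5GpSettingTorus.dir0 P), B5GpSettingTorus.dir0 P), Finset.mem_univ _⟩ _
        fun p _ => holN_pull_ten2_le P ε T p.1 p.2

/-- **the setting-level statements**: for `S' = g0Diag P a 0 P.K` and `S₀ = latticeSettingP12R (nP P) (MP P) a P.K` the maps
`σR`, `ιR`, `κR` satisfy the `dist_le`/`supp_map`/`cut_map`/`supNorm_map`/`holder_map`/`cutH_map` fields of `B5Transfer132.MapFacts`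
(as separate facts; the record also needs the pieces). [cite: Balaban1984PropagatorsI, (1.132) p.39] -/
theorem mapFacts_core (a : ℝ) :
    (∀ y y' : (latticeSettingP12R (nP P) (MP P) a P.K).Site,
        (latticeSettingP12R (nP P) (MP P) a P.K).dist y y' ≤ (g0Diag P a 0 P.K).dist (σR P y) (σR P y')) ∧
    (∀ (J : (latticeSettingP12R (nP P) (MP P) a P.K).Loc) (y' : (latticeSettingP12R (nP P) (MP P) a P.K).Site),
        (latticeSettingP12R (nP P) (MP P) a P.K).suppIn J y' → (g0Diag P a 0 P.K).suppIn (ιR P J) (σR P y')) ∧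
    (∀ (ζ : (latticeSettingP12R (nP P) (MP P) a P.K).Cut) (y : (latticeSettingP12R (nP P) (MP P) a P.K).Site),
        (latticeSettingP12R (nP P) (MP P) a P.K).cutIn ζ y → (g0Diag P a 0 P.K).cutIn (κR P ζ) (σR P y)) ∧
    (∀ J : (latticeSettingP12R (nP P) (MP P) a P.K).Loc,
        (g0Diag P a 0 P.K).supNorm (ιR P J) ≤ (latticeSettingP12R (nP P) (MP P) a P.K).supNorm J) ∧
    (∀ (ε : ℝ) (J : (latticeSettingP12R (nP P) (MP P) a P.K).Loc),
        (g0Diag P a 0 P.K).holder ε (ιR P J) ≤ (latticeSettingP12R (nP P) (MP P) a P.K).holder ε J) ∧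
    (∀ (α : ℝ) (ζ : (latticeSettingP12R (nP P) (MP P) a P.K).Cut),
        (g0Diag P a 0 P.K).cutH α (κR P ζ) ≤ (latticeSettingP12R (nP P) (MP P) a P.K).cutH α ζ) :=
  ⟨fun y y' => (dist_σR P y y').symm.le, fun J y' h => supp_ιR P a J y' h, fun ζ y h => cutIn_κR P ζ y h,
    fun J => supNormT_ιR_le P J, fun ε J => holder3_ιR_le P a ε J, fun α ζ => cutHV_κR_le P α ζ⟩

/-- **`‖ι J‖ = ‖J‖` at the settings of record** (both the printed weighted norm). [cite: Balaban1984PropagatorsI, (1.89) p.33, (1.21) p.21] -/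
theorem l2Norm_g0Diag_ιR (a : ℝ) (J : LocR (nP P) (MP P)) :
    (g0Diag P a 0 P.K).l2Norm (ιR P J) = (latticeSettingP12R (nP P) (MP P) a P.K).l2Norm J :=
  l2NormT_ιR P a J

end

end Literature.MathematicalPhysics.QuantumFieldTheory.Balaban1983to89.B5Carrier132Maps
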